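import Literature.MathematicalPhysics.KineticTheory.SeparablePairBand
import Literature.MathematicalPhysics.KineticTheory.LinearisedPhononCollisionOperator
import Literature.MathematicalPhysics.KineticTheory.HarmonicChaosDecomposition
import HarnessLib

/-!
# The pair band `E_K(p) = ω(p) + ω(K − p)` of the pinned chain: fibre operators, T-matrices `τ_K(z)`,
# pair kinematics (co-moving pairs, `κ*`), and the `(2,2)`-shell Faddeev system

Topic `Literature/MathematicalPhysics/KineticTheory` (definition request `defn-SeparableTwoBodyTMatrix`, parts
(iii)–(iv); abstract part `SeparableTwoBodyTMatrix.lean`, band/threshold part `SeparablePairBand.lean`,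
one-dimensional van Hove edge `BandEdgeVanHove.lean`).

THE PINNED-BAND INSTANCE wanted by line `separable-vertex-faddeev-pair-sector` of crux MourreDissolution:
per total-momentum fibre `K ∈ 𝕋` the first-order pair sector of the anharmonic Liouvillian is
"`E_K(p) = ω(p) + ω(K − p)` as a multiplication operator on `L²(𝕋)` + `λ·`(rank `≤ 2` separable operator)",
`ω = √(ω₂ + 2(1 − cos k))` the pinned band (`PinnedChainKinetic.dispersion` on `𝕋 = ℝ/2πℤ`,
`PhononBoltzmann.dispersion` on `ℝ`).

## Contents (all definitions with bodies; what is proved is marked)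

* §1 (`PhononBoltzmann`, angle variable on `ℝ`) PAIR KINEMATICS: `pairBandR ω₂ K p = ω(p) + ω(K − p)`;
  PROVED `E_K' (p) = ω'(p) − ω'(K − p)` (`hasDerivAt_pairBandR`), so critical points are exactly the points
  with equal group velocities (`deriv_pairBandR_eq_zero_iff`); the EXCHANGE-DIAGONAL points `p = K/2 + nπ`
  are always critical (`groupVelocity_half_add_int_mul_pi`); CO-MOVING pairs `IsCoMoving ω₂ K p`
  (`ω'(p) = ω'(K − p)`, `2p − K ∉ 2πℤ`); the group-velocity extremum: PROVED
  `ω'' = (cos k·ω² − sin²k)/ω³` (`hasDerivAt_groupVelocity`), `ω''(k) = 0 ⇔ cos²k − (ω₂+2)cos k + 1 = 0 ⇔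
  cos k = c₋(ω₂) := ((ω₂+2) − √((ω₂+2)² − 4))/2` (`deriv_groupVelocity_eq_zero_iff_cos`), `κ*(ω₂) = arccos c₋`
  (`kappaStar`, `cos_kappaStar`, `deriv_groupVelocity_kappaStar`) — the requester's `κ*` ("`cos κ*` =
  smaller root of `c² − (ω₂+2)c + 1`"). [folklore computations on ALS's band; cite: AokiLukkarinenSpohn2006,
  eqs. (3.4), (4.10)]
* §2 (`PinnedChainKinetic`, on `𝕋`) `pairBand ω₂ K : 𝕋 → ℝ` (continuous, `2√ω₂ ≤ E_K ≤ 2√(|ω₂|+4)`,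
  symmetric under `p ↦ K − p`), the FIBRE OPERATOR `pairFibreOp ω₂ K λ u v = M_{E_K} + λ Σ_i |u_i⟩⟨v_i|` on
  `L²(𝕋, dk; ℂ)`, its matrix `pairGMatrix = g_K(z)` (PROVED `= ∫ conj(v_i) u_j/(z − E_K) dk` off the band,
  `pairGMatrix_eq_integral`) and T-MATRIX `pairTMatrix = τ_K(z) = (1 − λ g_K(z))⁻¹`; PROVED: off the band
  `z ∈ σ(h_{K,λ}) ⇔ det(1 − λ g_K(z)) = 0` (`mem_spectrum_pairFibreOp_iff`) and the T-matrix formula for the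
  fibre resolvent (`resolvent_pairFibreOp`) — instances of the abstract file. [cite: Economou1983, §6.1]
* §3 (`HarmonicChaos`, the `(2,2)` zero-momentum shell) the FREE PAIR LIOUVILLIAN `M_Ω`,
  `Ω = sectorPhase ω₂ = ω₁ + ω₂ − ω₃ − ω₄` as a multiplication operator on `L²(Shell 2 2)`
  (`freePairLiouvillian`; PROVED `|Ω_{m,n}| ≤ (m+n)√(|ω₂|+4)` and `z ∈ ρ(M_Ω)` off the real axis,
  `mem_resolventSet_freePairLiouvillian`); the three PAIR CHANNELS `PairChannel = {created, annihilated, cross}`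
  (T, T′, X) and PROVED fibre forms of `Ω` on the shell: `Ω = E_K(k₁) − (ω₃ + ω₄)`, `K = k₃ + k₄`
  (created pair), `Ω = (ω₁ + ω₂) − E_K(k₃)` (annihilated pair), `Ω = X_Q(k₁) − X_Q(k₄)`, `Q = k₁ − k₃`,
  `X_Q(p) = ω(p) − ω(p − Q)` (cross pairs) (`sectorPhase_eq_created/annihilated/cross`); and the
  `(2,2)`-SHELL FADDEEV SYSTEM `IsPairFaddeevSolution ω₂ λ V z t F` := channel Lippmann–Schwinger for the
  three channel interactions `V` + Faddeev's equations for the components, with the resummation theorem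
  `(z − M_Ω − λΣV)(R₀ + R₀ (ΣF) R₀) = 1` off the real axis (`IsPairFaddeevSolution.rightInverse`).
  [cite: Faddeev1961] [cite: DreizlerKirchnerLudde2018, §7.5 eqs. (7.30)–(7.37)]

## What is NOT here (and why)

* The channel interactions `V_T, V_{T′}, V_X` themselves (Hartree multiplier + rank `≤ 2` fibrewise separable
  operators with kernels from ALS's vertex) — definition request D3 `AnharmonicPairBlock` of the same line;
  `IsPairFaddeevSolution` takes them as data.
* The requester's fibre analysis of `E_K` (critical set `= {p ≡ K/2 mod π} ∪` at most one co-moving pair,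
  existing iff `|K| > 2κ*`, global minima; numerically verified by the planner) is NOT asserted: only the
  critical-point equation, the diagonal critical points and the characterisation of `κ*` are proved here.
* Direct-integral decomposition of `M_Ω + λV` into the fibre operators `pairFibreOp` (needs D3's kernels).

## References

* K. Aoki, J. Lukkarinen, H. Spohn, J. Stat. Phys. 124 (2006), §3 eq. (3.4), §4 eqs. (4.2), (4.10).
  [cite: AokiLukkarinenSpohn2006, eqs. (3.4), (4.2), (4.10)]
* E. N. Economou, Green's Functions in Quantum Physics, 2nd ed., 1983, §6.1. [cite: Economou1983, §6.1]
* L. D. Faddeev, Sov. Phys. JETP 12 (1961) 1014. [cite: Faddeev1961]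
* R. M. Dreizler, T. Kirchner, C. S. Lüdde, Streutheorie in der nichtrelativistischen Quantenmechanik (2018),
  §7.5. [cite: DreizlerKirchnerLudde2018, §7.5 eqs. (7.30)–(7.37)]
-/

noncomputable section

open MeasureTheory Set
open scoped InnerProductSpace ComplexConjugate Matrix

/-! ## §1. Pair kinematics in the angle variable -/

namespace Literature.MathematicalPhysics.KineticTheory.PhononBoltzmann

open Real

/-- **The pair band** `E_K(p) = ω(p) + ω(K − p)` of two band phonons of total momentum `K` (angle variable,
`2π`-periodic in `p` and `K`). [cite: AokiLukkarinenSpohn2006, eqs. (3.4), (4.2)] -/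
def pairBandR (ω₂ K p : ℝ) : ℝ := dispersion ω₂ p + dispersion ω₂ (K - p)

/-- Exchange symmetry `E_K(K − p) = E_K(p)`. [folklore] -/
theorem pairBandR_sub (ω₂ K p : ℝ) : pairBandR ω₂ K (K - p) = pairBandR ω₂ K p := by
  rw [pairBandR, pairBandR, sub_sub_cancel, add_comm]

/-- **`E_K'(p) = ω'(p) − ω'(K − p)`**. [folklore] -/
theorem hasDerivAt_pairBandR {ω₂ : ℝ} (hω : 0 < ω₂) (K p : ℝ) :
    HasDerivAt (pairBandR ω₂ K) (groupVelocity ω₂ p - groupVelocity ω₂ (K - p)) p := by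
  have h1 := hasDerivAt_dispersion hω p
  have h2 : HasDerivAt (fun p => dispersion ω₂ (K - p)) (-groupVelocity ω₂ (K - p)) p :=
    HasDerivAt.comp_const_sub K p (hasDerivAt_dispersion hω (K - p))
  exact (h1.add h2).congr_deriv (by ring)

/-- Critical points of the pair band are exactly the pairs with EQUAL GROUP VELOCITIES.
[folklore] -/
theorem deriv_pairBandR_eq_zero_iff {ω₂ : ℝ} (hω : 0 < ω₂) (K p : ℝ) :
    deriv (pairBandR ω₂ K) p = 0 ↔ groupVelocity ω₂ p = groupVelocity ω₂ (K - p) := by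
  rw [(hasDerivAt_pairBandR hω K p).deriv, sub_eq_zero]

/-- The EXCHANGE-DIAGONAL points `p = K/2 + nπ` (`{p, K − p}` equal modulo `2π`) are always critical:
`ω'(K/2 + nπ) = ω'(K − (K/2 + nπ))`. [folklore] -/
theorem groupVelocity_half_add_int_mul_pi (ω₂ K : ℝ) (n : ℤ) :
    groupVelocity ω₂ (K / 2 + n * π) = groupVelocity ω₂ (K - (K / 2 + n * π)) := by
  have h : K - (K / 2 + n * π) = (K / 2 + n * π) - n * (2 * π) := by ring
  rw [h, (groupVelocity_periodic ω₂).sub_int_mul_eq]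

/-- **A CO-MOVING pair** `{p, K − p}`: equal group velocities at two momenta that are DISTINCT modulo `2π`
(`2p − K ∉ 2πℤ`), i.e. a critical point of `E_K` off the exchange diagonal. [folklore] -/
def IsCoMoving (ω₂ K p : ℝ) : Prop :=
  groupVelocity ω₂ p = groupVelocity ω₂ (K - p) ∧ ∀ n : ℤ, 2 * p - K ≠ n * (2 * π)

/-- **`ω''(k) = (cos k · ω(k)² − sin²k)/ω(k)³`** (derivative of the group velocity `sin k/ω(k)`).
[folklore] -/
theorem hasDerivAt_groupVelocity {ω₂ : ℝ} (hω : 0 < ω₂) (k : ℝ) :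
    HasDerivAt (groupVelocity ω₂)
      ((Real.cos k * dispersion ω₂ k ^ 2 - Real.sin k ^ 2) / dispersion ω₂ k ^ 3) k := by
  have hω0 := (dispersion_pos hω k).ne'
  have h := (Real.hasDerivAt_sin k).div (hasDerivAt_dispersion hω k) hω0
  unfold groupVelocity
  refine h.congr_deriv ?_
  rw [groupVelocity]
  field_simp

/-- `ω''(k) = 0 ⇔ cos²k − (ω₂ + 2) cos k + 1 = 0`. [folklore] -/
theorem deriv_groupVelocity_eq_zero_iff {ω₂ : ℝ} (hω : 0 < ω₂) (k : ℝ) :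
    deriv (groupVelocity ω₂) k = 0 ↔ Real.cos k ^ 2 - (ω₂ + 2) * Real.cos k + 1 = 0 := by
  rw [(hasDerivAt_groupVelocity hω k).deriv, div_eq_zero_iff,
    or_iff_left (pow_ne_zero 3 (dispersion_pos hω k).ne'), dispersion_sq hω.le, Real.sin_sq]
  constructor <;> intro h <;> linear_combination -h

/-- `c₋(ω₂) = ((ω₂ + 2) − √((ω₂ + 2)² − 4))/2`, the smaller root of `c² − (ω₂ + 2)c + 1` (the larger one is
`1/c₋ > 1`). [folklore] -/
def cosKappaStar (ω₂ : ℝ) : ℝ := ((ω₂ + 2) - Real.sqrt ((ω₂ + 2) ^ 2 - 4)) / 2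

/-- **`κ*(ω₂) = arccos c₋(ω₂) ∈ (0, π/2)`**: the momentum of maximal group velocity on `(0, π)`.
[folklore] -/
def kappaStar (ω₂ : ℝ) : ℝ := Real.arccos (cosKappaStar ω₂)

/-- `c₋` solves the quadratic. [folklore] -/
theorem cosKappaStar_quadratic {ω₂ : ℝ} (hω : 0 ≤ ω₂) :
    cosKappaStar ω₂ ^ 2 - (ω₂ + 2) * cosKappaStar ω₂ + 1 = 0 := by
  have hs := Real.sq_sqrt (show (0 : ℝ) ≤ (ω₂ + 2) ^ 2 - 4 by nlinarith)
  rw [cosKappaStar]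
  linear_combination (1 / 4 : ℝ) * hs

/-- `0 < c₋`. [folklore] -/
theorem cosKappaStar_pos {ω₂ : ℝ} (hω : 0 < ω₂) : 0 < cosKappaStar ω₂ := by
  rw [cosKappaStar]
  have : Real.sqrt ((ω₂ + 2) ^ 2 - 4) < ω₂ + 2 := (Real.sqrt_lt' (by linarith)).2 (by linarith)
  linarith

/-- `c₋ < 1` (for `ω₂ > 0`). [folklore] -/
theorem cosKappaStar_lt_one {ω₂ : ℝ} (hω : 0 < ω₂) : cosKappaStar ω₂ < 1 := by
  rw [cosKappaStar]
  have : ω₂ < Real.sqrt ((ω₂ + 2) ^ 2 - 4) := (Real.lt_sqrt hω.le).2 (by nlinarith)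
  linarith

/-- `cos κ* = c₋`. [folklore] -/
theorem cos_kappaStar {ω₂ : ℝ} (hω : 0 < ω₂) : Real.cos (kappaStar ω₂) = cosKappaStar ω₂ :=
  Real.cos_arccos (by linarith [cosKappaStar_pos hω]) (cosKappaStar_lt_one hω).le

/-- `κ* ∈ (0, π/2)`. [folklore] -/
theorem kappaStar_mem_Ioo {ω₂ : ℝ} (hω : 0 < ω₂) : kappaStar ω₂ ∈ Ioo 0 (π / 2) :=
  ⟨Real.arccos_pos.2 (cosKappaStar_lt_one hω), Real.arccos_lt_pi_div_two.2 (cosKappaStar_pos hω)⟩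

/-- **The critical points of the group velocity are exactly `cos k = c₋(ω₂)`** (the other root of the
quadratic exceeds `1`). [folklore] -/
theorem deriv_groupVelocity_eq_zero_iff_cos {ω₂ : ℝ} (hω : 0 < ω₂) (k : ℝ) :
    deriv (groupVelocity ω₂) k = 0 ↔ Real.cos k = cosKappaStar ω₂ := by
  rw [deriv_groupVelocity_eq_zero_iff hω]
  have hs := Real.sq_sqrt (show (0 : ℝ) ≤ (ω₂ + 2) ^ 2 - 4 by nlinarith)
  have hfac : ∀ x : ℝ, x ^ 2 - (ω₂ + 2) * x + 1 =
      (x - cosKappaStar ω₂) * (x - ((ω₂ + 2) + Real.sqrt ((ω₂ + 2) ^ 2 - 4)) / 2) := fun x => by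
    rw [cosKappaStar]
    linear_combination (1 / 4 : ℝ) * hs
  have hbig : 1 < ((ω₂ + 2) + Real.sqrt ((ω₂ + 2) ^ 2 - 4)) / 2 := by
    have := Real.sqrt_nonneg ((ω₂ + 2) ^ 2 - 4)
    linarith
  rw [hfac, mul_eq_zero, sub_eq_zero, sub_eq_zero, or_iff_left]
  exact ne_of_lt ((Real.cos_le_one k).trans_lt hbig)

/-- `ω''(κ*) = 0`. [folklore] -/
theorem deriv_groupVelocity_kappaStar {ω₂ : ℝ} (hω : 0 < ω₂) : deriv (groupVelocity ω₂) (kappaStar ω₂) = 0 := by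
  rw [deriv_groupVelocity_eq_zero_iff_cos hω, cos_kappaStar hω]

end Literature.MathematicalPhysics.KineticTheory.PhononBoltzmann

/-! ## §2. The pair band on `𝕋`, the fibre operators and their T-matrices -/

namespace Literature.MathematicalPhysics.KineticTheory.HeatConduction

namespace PinnedChainKinetic

/-- **The pair band on the Brillouin circle**: `E_K(p) = ω(p) + ω(K − p)`, `K, p ∈ 𝕋`.
[cite: AokiLukkarinenSpohn2006, eqs. (3.4), (4.2)] -/
def pairBand (ω₂ : ℝ) (K p : 𝕋) : ℝ := dispersion ω₂ p + dispersion ω₂ (K - p)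

/-- The circle pair band descends from the angle-variable one. [folklore] -/
@[simp] theorem pairBand_coe (ω₂ K p : ℝ) :
    pairBand ω₂ (K : 𝕋) (p : 𝕋) = PhononBoltzmann.pairBandR ω₂ K p := by
  rw [pairBand, ← AddCircle.coe_sub]
  rfl

/-- Exchange symmetry `E_K(K − p) = E_K(p)`. [folklore] -/
theorem pairBand_sub (ω₂ : ℝ) (K p : 𝕋) : pairBand ω₂ K (K - p) = pairBand ω₂ K p := by
  rw [pairBand, pairBand, sub_sub_cancel, add_comm]

/-- `E_K` is continuous. [folklore] -/
theorem continuous_pairBand (ω₂ : ℝ) (K : 𝕋) : Continuous (pairBand ω₂ K) := by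
  have h := continuous_dispersion ω₂
  unfold pairBand
  fun_prop

/-- `E_K` is measurable. [folklore] -/
theorem measurable_pairBand (ω₂ : ℝ) (K : 𝕋) : Measurable (pairBand ω₂ K) :=
  (continuous_pairBand ω₂ K).measurable

/-- `0 ≤ E_K`. [folklore] -/
theorem pairBand_nonneg (ω₂ : ℝ) (K p : 𝕋) : 0 ≤ pairBand ω₂ K p :=
  add_nonneg (dispersion_nonneg _ _) (dispersion_nonneg _ _)

/-- The gap: `2√ω₂ ≤ E_K`. [folklore] -/
theorem le_pairBand (ω₂ : ℝ) (K p : 𝕋) : 2 * Real.sqrt ω₂ ≤ pairBand ω₂ K p := by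
  unfold pairBand
  linarith [sqrt_le_dispersion ω₂ p, sqrt_le_dispersion ω₂ (K - p)]

/-- `|E_K| ≤ 2√(|ω₂| + 4)` (a bounded band). [folklore] -/
theorem abs_pairBand_le (ω₂ : ℝ) (K p : 𝕋) : |pairBand ω₂ K p| ≤ 2 * Real.sqrt (|ω₂| + 4) := by
  rw [abs_of_nonneg (pairBand_nonneg ω₂ K p)]
  unfold pairBand
  linarith [dispersion_le ω₂ p, dispersion_le ω₂ (K - p)]

variable {ι : Type*}

/-- **The fibre operator `h_{K,λ} = M_{E_K} + λ Σ_i |u_i⟩⟨v_i|`** on `L²(𝕋, dk; ℂ)`: the resummed first-order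
pair sector of total momentum `K` (rank `|ι| ≤ 2` for the requester). [cite: Economou1983, §6.1 eqs. (6.1)–(6.3)] -/
def pairFibreOp [Fintype ι] (ω₂ : ℝ) (K : 𝕋) (lam : ℂ) (u v : ι → Lp ℂ 2 μ𝕋) :
    Lp ℂ 2 μ𝕋 →L[ℂ] Lp ℂ 2 μ𝕋 :=
  FiniteRank.perturb (FiniteRank.bandOp μ𝕋 (pairBand ω₂ K)) lam u v

/-- **`g_K(z)_{ij} = ⟪v_i, (z − M_{E_K})⁻¹ u_j⟫`**. [cite: Economou1983, §6.1 eq. (6.7)] -/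
def pairGMatrix (ω₂ : ℝ) (K : 𝕋) (u v : ι → Lp ℂ 2 μ𝕋) (z : ℂ) : Matrix ι ι ℂ :=
  FiniteRank.gMatrix (FiniteRank.bandOp μ𝕋 (pairBand ω₂ K)) u v z

/-- **The fibre T-matrix `τ_K(z) = (1 − λ g_K(z))⁻¹`**. [cite: Economou1983, §6.1 eq. (6.6)] -/
def pairTMatrix [Fintype ι] [DecidableEq ι] (ω₂ : ℝ) (K : 𝕋) (lam : ℂ) (u v : ι → Lp ℂ 2 μ𝕋) (z : ℂ) :
    Matrix ι ι ℂ :=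
  FiniteRank.tMatrix (FiniteRank.bandOp μ𝕋 (pairBand ω₂ K)) lam u v z

/-- Off the band: `g_K(z)_{ij} = ∫ conj(v_i) u_j /(z − E_K) dk`. [cite: Economou1983, §6.1 eq. (6.7)] -/
theorem pairGMatrix_eq_integral (ω₂ : ℝ) (K : 𝕋) (u v : ι → Lp ℂ 2 μ𝕋) {z : ℂ} {δ : ℝ} (hδ : 0 < δ)
    (hz : ∀ p, δ ≤ ‖z - pairBand ω₂ K p‖) (i j : ι) :
    pairGMatrix ω₂ K u v z i j =
      ∫ p, conj (v i p) * ((z - (pairBand ω₂ K p : ℂ))⁻¹ * u j p) ∂μ𝕋 :=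
  FiniteRank.gMatrix_bandOp (measurable_pairBand ω₂ K) (abs_pairBand_le ω₂ K) hδ hz u v i j

/-- **Off the band the spectrum of the fibre operator is `{det(1 − λ g_K(z)) = 0}`** (finite determinant;
rank one: `λ g_K(z) = 1`, rank two: the `2 × 2` determinant). [cite: Kato1966, Ch. IV §6.2 Thm 6.2] -/
theorem mem_spectrum_pairFibreOp_iff [Fintype ι] [DecidableEq ι] (ω₂ : ℝ) (K : 𝕋) (lam : ℂ)
    (u v : ι → Lp ℂ 2 μ𝕋) {z : ℂ} {δ : ℝ} (hδ : 0 < δ) (hz : ∀ p, δ ≤ ‖z - pairBand ω₂ K p‖) :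
    z ∈ spectrum ℂ (pairFibreOp ω₂ K lam u v) ↔ (1 - lam • pairGMatrix ω₂ K u v z).det = 0 :=
  FiniteRank.mem_spectrum_perturb_iff
    (FiniteRank.resolvent_bandOp (measurable_pairBand ω₂ K) (abs_pairBand_le ω₂ K) hδ hz).1

/-- **The fibre T-matrix identity**: off the band and off `{det = 0}`,
`(z − h_{K,λ})⁻¹ = R₀ + R₀ · λUτ_K(z)V* · R₀` with `R₀ = M_{(z − E_K)⁻¹}`. [cite: Economou1983, §6.1 eq. (6.8)] -/
theorem resolvent_pairFibreOp [Fintype ι] [DecidableEq ι] (ω₂ : ℝ) (K : 𝕋) (lam : ℂ)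
    (u v : ι → Lp ℂ 2 μ𝕋) {z : ℂ} {δ : ℝ} (hδ : 0 < δ) (hz : ∀ p, δ ≤ ‖z - pairBand ω₂ K p‖)
    (hd : (1 - lam • pairGMatrix ω₂ K u v z).det ≠ 0) :
    z ∈ resolventSet ℂ (pairFibreOp ω₂ K lam u v) ∧
      resolvent (pairFibreOp ω₂ K lam u v) z =
        FiniteRank.mulOp μ𝕋 (fun p => (z - (pairBand ω₂ K p : ℂ))⁻¹) +
          FiniteRank.mulOp μ𝕋 (fun p => (z - (pairBand ω₂ K p : ℂ))⁻¹) ∘L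
            FiniteRank.tOperator (FiniteRank.bandOp μ𝕋 (pairBand ω₂ K)) lam u v z ∘L
              FiniteRank.mulOp μ𝕋 (fun p => (z - (pairBand ω₂ K p : ℂ))⁻¹) := by
  have hρ := FiniteRank.resolvent_bandOp (m := μ𝕋) (measurable_pairBand ω₂ K) (abs_pairBand_le ω₂ K) hδ hz
  have h := FiniteRank.resolvent_perturb (lam := lam) (u := u) (v := v) hρ.1 hd
  rw [hρ.2] at h
  exact h

end PinnedChainKinetic

/-! ## §3. The `(2,2)` zero-momentum shell: free pair Liouvillian, channels, fibre forms of `Ω`, Faddeev -/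

namespace HarmonicChaos

open PinnedChainKinetic

/-- `|Ω_{m,n}| ≤ (m + n)√(|ω₂| + 4)`: the free frequency is a bounded multiplier. [folklore] -/
theorem abs_sectorPhase_le (ω₂ : ℝ) {m n : ℕ} (κ : Shell m n) :
    |sectorPhase ω₂ κ| ≤ (m + n) * Real.sqrt (|ω₂| + 4) := by
  set M := Real.sqrt (|ω₂| + 4) with hM
  have hM0 : 0 ≤ M := Real.sqrt_nonneg _
  have hA : ∑ i, dispersion ω₂ ((κ : SectorConfig m n).1 i) ≤ m * M := by
    have h := Finset.sum_le_card_nsmul Finset.univ (fun i => dispersion ω₂ ((κ : SectorConfig m n).1 i)) M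
      fun i _ => dispersion_le ω₂ _
    simpa using h
  have hB : ∑ j, dispersion ω₂ ((κ : SectorConfig m n).2 j) ≤ n * M := by
    have h := Finset.sum_le_card_nsmul Finset.univ (fun j => dispersion ω₂ ((κ : SectorConfig m n).2 j)) M
      fun j _ => dispersion_le ω₂ _
    simpa using h
  have hA0 : 0 ≤ ∑ i, dispersion ω₂ ((κ : SectorConfig m n).1 i) :=
    Finset.sum_nonneg fun i _ => dispersion_nonneg _ _
  have hB0 : 0 ≤ ∑ j, dispersion ω₂ ((κ : SectorConfig m n).2 j) :=
    Finset.sum_nonneg fun j _ => dispersion_nonneg _ _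
  rw [sectorPhase, abs_sub_le_iff]
  have hm : (0 : ℝ) ≤ m * M := by positivity
  have hn : (0 : ℝ) ≤ n * M := by positivity
  constructor <;> nlinarith

/-- **The free pair Liouvillian `M_Ω` on `L²(Shell 2 2)`**: multiplication by
`Ω(k₁,k₂;k₃,k₄) = ω₁ + ω₂ − ω₃ − ω₄` (`sectorPhase ω₂`), the `(2,2)` block of the harmonic generator.
[cite: AokiLukkarinenSpohn2006, eqs. (3.7), (4.2)] -/
def freePairLiouvillian (ω₂ : ℝ) : SectorSpace 2 2 →L[ℂ] SectorSpace 2 2 :=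
  FiniteRank.bandOp (shellMeasure 2 2) (sectorPhase ω₂)

/-- **Off the real axis `z ∈ ρ(M_Ω)` and `(z − M_Ω)⁻¹ = M_{(z − Ω)⁻¹}`** (distance `≥ |Im z|`). [folklore] -/
theorem mem_resolventSet_freePairLiouvillian (ω₂ : ℝ) {z : ℂ} (hz : z.im ≠ 0) :
    z ∈ resolventSet ℂ (freePairLiouvillian ω₂) ∧
      resolvent (freePairLiouvillian ω₂) z =
        FiniteRank.mulOp (shellMeasure 2 2) (fun κ => (z - (sectorPhase ω₂ κ : ℂ))⁻¹) := by
  refine FiniteRank.resolvent_bandOp (measurable_sectorPhase ω₂ 2 2)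
    (B := (2 + 2) * Real.sqrt (|ω₂| + 4)) (fun κ => by exact_mod_cast abs_sectorPhase_le ω₂ κ)
    (abs_pos.2 hz) fun κ => ?_
  calc |z.im| = |(z - (sectorPhase ω₂ κ : ℂ)).im| := by simp
    _ ≤ ‖z - (sectorPhase ω₂ κ : ℂ)‖ := Complex.abs_im_le_norm _

/-- The three PAIR CHANNELS of the `(2,2)` shell: the created pair `(k₁,k₂)` (T), the annihilated pair
`(k₃,k₄)` (T′), and the cross pairs `(k₁,k₃)∥(k₂,k₄)` (X). [folklore] -/
inductive PairChannel
  | created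
  | annihilated
  | cross
  deriving DecidableEq, Fintype

/-- The CROSS BAND `X_Q(p) = ω(p) − ω(p − Q)` of a created/annihilated pair of momentum transfer `Q`.
[folklore] -/
def crossBand (ω₂ : ℝ) (Q p : 𝕋) : ℝ := dispersion ω₂ p - dispersion ω₂ (p - Q)

/-- On the `(2,2)` shell `k₁ + k₂ = k₃ + k₄`. [folklore] -/
theorem shell_two_two_sum (κ : Shell 2 2) :
    (κ : SectorConfig 2 2).1 0 + (κ : SectorConfig 2 2).1 1 =
      (κ : SectorConfig 2 2).2 0 + (κ : SectorConfig 2 2).2 1 := by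
  have h := (mem_shell_iff (κ : SectorConfig 2 2)).1 κ.2
  rw [Fin.sum_univ_two, Fin.sum_univ_two, sub_eq_zero] at h
  exact h

/-- **Created-pair fibre form**: `Ω = E_K(k₁) − (ω(k₃) + ω(k₄))` with `K = k₃ + k₄` (`= k₁ + k₂`): on each
T-fibre `Ω` is the pair band of §2 minus a spectator constant. [cite: AokiLukkarinenSpohn2006, eq. (4.2)] -/
theorem sectorPhase_eq_created (ω₂ : ℝ) (κ : Shell 2 2) :
    sectorPhase ω₂ κ =
      pairBand ω₂ ((κ : SectorConfig 2 2).2 0 + (κ : SectorConfig 2 2).2 1) ((κ : SectorConfig 2 2).1 0) -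
        (dispersion ω₂ ((κ : SectorConfig 2 2).2 0) + dispersion ω₂ ((κ : SectorConfig 2 2).2 1)) := by
  rw [← shell_two_two_sum, pairBand, add_sub_cancel_left, sectorPhase, Fin.sum_univ_two, Fin.sum_univ_two]

/-- **Annihilated-pair fibre form**: `Ω = (ω(k₁) + ω(k₂)) − E_K(k₃)`, `K = k₁ + k₂`.
[cite: AokiLukkarinenSpohn2006, eq. (4.2)] -/
theorem sectorPhase_eq_annihilated (ω₂ : ℝ) (κ : Shell 2 2) :
    sectorPhase ω₂ κ =
      (dispersion ω₂ ((κ : SectorConfig 2 2).1 0) + dispersion ω₂ ((κ : SectorConfig 2 2).1 1)) -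
        pairBand ω₂ ((κ : SectorConfig 2 2).1 0 + (κ : SectorConfig 2 2).1 1) ((κ : SectorConfig 2 2).2 0) := by
  rw [shell_two_two_sum, pairBand, add_sub_cancel_left, sectorPhase, Fin.sum_univ_two, Fin.sum_univ_two]

/-- **Cross-pair fibre form**: `Ω = X_Q(k₁) − X_Q(k₄)` with `Q = k₁ − k₃` (`= k₄ − k₂`),
`X_Q(p) = ω(p) − ω(p − Q)`. [cite: AokiLukkarinenSpohn2006, eq. (4.2)] -/
theorem sectorPhase_eq_cross (ω₂ : ℝ) (κ : Shell 2 2) :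
    sectorPhase ω₂ κ =
      crossBand ω₂ ((κ : SectorConfig 2 2).1 0 - (κ : SectorConfig 2 2).2 0) ((κ : SectorConfig 2 2).1 0) -
        crossBand ω₂ ((κ : SectorConfig 2 2).1 0 - (κ : SectorConfig 2 2).2 0) ((κ : SectorConfig 2 2).2 1) := by
  have h := shell_two_two_sum κ
  have h4 : (κ : SectorConfig 2 2).2 1 - ((κ : SectorConfig 2 2).1 0 - (κ : SectorConfig 2 2).2 0) =
      (κ : SectorConfig 2 2).1 1 := by
    have h' : (κ : SectorConfig 2 2).1 1 =
        (κ : SectorConfig 2 2).2 0 + (κ : SectorConfig 2 2).2 1 - (κ : SectorConfig 2 2).1 0 := by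
      rw [← h]; abel
    rw [h']; abel
  rw [crossBand, crossBand, sub_sub_cancel, h4, sectorPhase, Fin.sum_univ_two, Fin.sum_univ_two]
  ring

/-- **THE `(2,2)`-SHELL FADDEEV SYSTEM** for `M_Ω + λ(V_T + V_{T′} + V_X)` at spectral parameter `z`: the
channel T-operators `t_a = λV_a + λV_a(z − M_Ω)⁻¹t_a` of the three pair channels and Faddeev's equations
`F_a = t_a + t_a (z − M_Ω)⁻¹ Σ_{b ≠ a} F_b` for the components (with separable fibrewise `V_a` the `t_a` act
fibrewise through the T-matrices `τ_K(z)` of §2 — the one-variable integral equations of the request).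
[cite: Faddeev1961] [cite: DreizlerKirchnerLudde2018, §7.5 eqs. (7.30)–(7.37)] -/
def IsPairFaddeevSolution (ω₂ : ℝ) (lam : ℂ) (V : PairChannel → SectorSpace 2 2 →L[ℂ] SectorSpace 2 2)
    (z : ℂ) (t F : PairChannel → SectorSpace 2 2 →L[ℂ] SectorSpace 2 2) : Prop :=
  (∀ a, FiniteRank.IsChannelTOperator (freePairLiouvillian ω₂) lam (V a) z (t a)) ∧
    FiniteRank.IsFaddeevSolution (freePairLiouvillian ω₂) t z F

/-- **Faddeev resummation on the `(2,2)` shell**: off the real axis a solution of the pair Faddeev system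
inverts `z − M_Ω − λΣ_aV_a` from the right by `R₀ + R₀(Σ_a F_a)R₀`, `R₀ = M_{(z − Ω)⁻¹}`.
[cite: Faddeev1961] [cite: DreizlerKirchnerLudde2018, §7.5] -/
theorem IsPairFaddeevSolution.rightInverse {ω₂ : ℝ} {lam : ℂ}
    {V : PairChannel → SectorSpace 2 2 →L[ℂ] SectorSpace 2 2} {z : ℂ}
    {t F : PairChannel → SectorSpace 2 2 →L[ℂ] SectorSpace 2 2} (hz : z.im ≠ 0)
    (h : IsPairFaddeevSolution ω₂ lam V z t F) :
    (z • (1 : SectorSpace 2 2 →L[ℂ] SectorSpace 2 2) - (freePairLiouvillian ω₂ + lam • ∑ a, V a)) *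
        (resolvent (freePairLiouvillian ω₂) z +
          resolvent (freePairLiouvillian ω₂) z ∘L (∑ a, F a) ∘L resolvent (freePairLiouvillian ω₂) z) = 1 :=
  h.2.rightInverse (mem_resolventSet_freePairLiouvillian ω₂ hz).1 h.1

end HarmonicChaos

end Literature.MathematicalPhysics.KineticTheory.HeatConduction
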